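import Summits.Parity.GeneralizedHardyLittlewood.Theorems.LeeYangFibresCellParityLawKernelDefs
import Summits.Parity.GeneralizedHardyLittlewood.Theorems.LeeYangFibresCellParityLawMertensAux
import Summits.Parity.GeneralizedHardyLittlewood.Theorems.LeeYangFibresCellParityLawEulerRatio
import Summits.Parity.GeneralizedHardyLittlewood.Theorems.LeeYangFibresCellParityLawSingularRatio
import Summits.Parity.GeneralizedHardyLittlewood.Theorems.LeeYangFibresCellParityLawDimension
import Literature.NumberTheory.Sieve.SmoothRoughDecomposition
import HarnessLib

/-!
# Route `LeeYangFibres`, crux `CellParityLaw` (stmt-Parity-14109), line `section-annihilator`: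
# the head of Bombieri's constant from below (registered stub `stub_sectionMertensLowerHead`, v13)

For a non-degenerate system `Ψ = (ψ₀, …, ψ_t)` of one-dimensional forms `ψ_k(n) = a_k n + b_k` of
size `‖Ψ‖_N ≤ L`, a coordinate `i` with section density `g = sectionDensity Ψ i`, `g(p) < 1` at every
prime and `𝔖(Ψ₋ᵢ) ≠ 0`, write `E_p = (1 - g(p))/(1 - 1/p)` for the Euler factors of Bombieri's constant
`H = H_{Ψ,i} = lim_x ∏_{p ≤ x} E_p` (`sectionH`; `MertensAux.tendsto_eulerPartial`). The landed companion
`stub_sectionMertensHead` (`Theorems/…MertensAux.lean`) bounds the HEAD `∏_{p<m} E_p` from ABOVE by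
`H (1 + 16t/m)`; here we bound it from BELOW:

`∏_{p<m} E_p ≥ H (1 - (2t+2) log N / m)` for `m ≥ 2` and `N ≥ L(2L²)^t + 1`

(statement `SectionMertensLowerHead` of the vocabulary file `…KernelDefs.lean`, with `C = 2t + 2`).

Proof. At a prime `p` one has `g(p) = (G' - G)/G'` with `G = goodCount Ψ p ≤ G' = goodCount Ψ₋ᵢ p ≤ p`
(`EulerRatioAux.sectionDensity_prime`), so `g(p) ≥ 0` (`DimensionAux.sectionDensity_prime_nonneg`) and
`E_p ≤ (1 - 1/p)⁻¹` always. If moreover `p`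
does not divide the cross-discriminant `Δ = |a_i| ∏_{k ≠ i} |a_i b_k - a_k b_i|` (a non-zero integer
`≤ L(2L²N)^t`, `SingularRatio.crossDisc_ne_zero` / `crossDisc_le`), then `ψ_i` has a root mod `p` at
which no other form vanishes (`SingularRatio.exists_root`), so `G' ≥ G + 1`, `g(p) ≥ 1/G' ≥ 1/p` and
`E_p ≤ 1`. Hence every tail `∏_{m ≤ p ≤ x} E_p` is at most `(1 - 1/m)^{-ω(Δ)}`, and
`∏_{p ≤ x} E_p · (1 - 1/m)^{ω(Δ)} ≤ ∏_{p<m} E_p`; in the limit `H (1 - 1/m)^{ω(Δ)} ≤ ∏_{p<m} E_p`.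
Bernoulli gives `(1 - 1/m)^{ω} ≥ 1 - ω/m`, and `2^{ω(Δ)} ≤ Δ ≤ N^{t+1}` (the tree's
`card_primeFactors_mul_log_le`) gives `ω(Δ) ≤ (t+1) log N/log 2 ≤ (2t+2) log N`.

References: E. Bombieri, *The asymptotic sieve*, Rend. Accad. Naz. XL (5) 1/2 (1975/76) 243–269
[BombieriAsymptoticSieve1976]; B. Green, T. Tao, Ann. of Math. 171 (2010), Lemma 1.3 [GreenTao2010].
-/

noncomputable section

open scoped BigOperators Topology Classical
open Finset Filter Literature.NumberTheory.Sieve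

namespace Summit.Parity.GeneralizedHardyLittlewood.Cruxes.CellParityLaw.SectionAnnihilator

namespace SectionMertensLowerHeadAux

variable {t : ℕ}

/-! ## One Euler factor from above -/

/-- `E_p ≤ (1 - 1/p)⁻¹` at every prime (`g(p) ≥ 0`, `DimensionAux.sectionDensity_prime_nonneg`). -/
theorem eulerFactor_le_inv (Ψ : Fin (t + 1) → AffLinForm 1) (i : Fin (t + 1)) {p : ℕ}
    (hp : p.Prime) :
    (1 - sectionDensity Ψ i p) / (1 - (p : ℝ)⁻¹) ≤ (1 - (p : ℝ)⁻¹)⁻¹ := by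
  haveI := Fact.mk hp
  have h1p : 0 < 1 - (p : ℝ)⁻¹ :=
    sub_pos.mpr (inv_lt_one_of_one_lt₀ (by exact_mod_cast hp.one_lt : (1 : ℝ) < p))
  rw [div_eq_mul_inv]
  exact mul_le_of_le_one_left (inv_nonneg.mpr h1p.le)
    (sub_le_self _ (DimensionAux.sectionDensity_prime_nonneg Ψ i p))

/-- **Off the cross-discriminant the Euler factor is at most one**: if the prime `p` divides no
multiple `Δ` of `|a_i|` and of all `|a_i b_k - a_k b_i|`, then `ψ_i` has a root mod `p` at which no
other form vanishes (`SingularRatio.exists_root`), so `G' ≥ G + 1` (`SingularRatio.goodCount_lt_removeNth`)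
and, as `G' ≤ p`, `g(p) = (G' - G)/G' ≥ 1/p`, i.e. `E_p ≤ 1`. -/
theorem eulerFactor_le_one (Ψ : Fin (t + 1) → AffLinForm 1) (i : Fin (t + 1)) {Δ : ℕ}
    (hΔa : ((Ψ i).coeff 0).natAbs ∣ Δ)
    (hΔD : ∀ k : Fin t, ((Ψ i).coeff 0 * (Ψ (i.succAbove k)).const -
      (Ψ (i.succAbove k)).coeff 0 * (Ψ i).const).natAbs ∣ Δ)
    {p : ℕ} (hp : p.Prime) (hpΔ : ¬ p ∣ Δ) :
    (1 - sectionDensity Ψ i p) / (1 - (p : ℝ)⁻¹) ≤ 1 := by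
  haveI := Fact.mk hp
  obtain ⟨v, hv, hv'⟩ := SingularRatio.exists_root Ψ i (p := p)
    (fun h => hpΔ ((Int.natCast_dvd.mp ((ZMod.intCast_zmod_eq_zero_iff_dvd _ p).mp h)).trans hΔa))
    (fun k h => hpΔ ((Int.natCast_dvd.mp
      ((ZMod.intCast_zmod_eq_zero_iff_dvd _ p).mp h)).trans (hΔD k)))
  have hG : (goodCount Ψ p : ℝ) + 1 ≤ goodCount (Fin.removeNth i Ψ) p := by
    exact_mod_cast SingularRatio.goodCount_lt_removeNth Ψ i p hv hv'
  have hG' : (goodCount (Fin.removeNth i Ψ) p : ℝ) ≤ p := by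
    have h1 : goodCount (Fin.removeNth i Ψ) p ≤ Fintype.card (Fin 1 → ZMod p) :=
      Finset.card_le_univ _
    rw [card_zmod_pow, pow_one] at h1
    exact_mod_cast h1
  have hG0 : (0 : ℝ) ≤ goodCount Ψ p := Nat.cast_nonneg _
  have hG'0 : (0 : ℝ) < goodCount (Fin.removeNth i Ψ) p := by linarith
  have hp0 : (0 : ℝ) < p := by linarith
  have h1p : 0 < 1 - (p : ℝ)⁻¹ :=
    sub_pos.mpr (inv_lt_one_of_one_lt₀ (by exact_mod_cast hp.one_lt : (1 : ℝ) < p))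
  rw [div_le_one h1p, EulerRatioAux.sectionDensity_prime Ψ i, sub_le_sub_iff_left,
    inv_eq_one_div, div_le_div_iff₀ hp0 hG'0]
  nlinarith [mul_le_mul_of_nonneg_left hG hp0.le]

/-! ## The tail of Bombieri's constant from above -/

/-- **The tail is at most `(1 - 1/m)^{-ω(Δ)}`**: for `m ≥ 2` and every `x`, the factors `E_p`,
`p ≥ m`, are `≥ 0` (`g < 1`), `≤ 1` off the prime factors of `Δ ≠ 0` (`eulerFactor_le_one`) and
`≤ (1 - 1/p)⁻¹ ≤ (1 - 1/m)⁻¹` on them (`eulerFactor_le_inv`). -/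
theorem tail_le (Ψ : Fin (t + 1) → AffLinForm 1) (i : Fin (t + 1))
    (hg1 : ∀ p : ℕ, p.Prime → sectionDensity Ψ i p < 1) {Δ : ℕ} (hΔ0 : Δ ≠ 0)
    (hΔa : ((Ψ i).coeff 0).natAbs ∣ Δ)
    (hΔD : ∀ k : Fin t, ((Ψ i).coeff 0 * (Ψ (i.succAbove k)).const -
      (Ψ (i.succAbove k)).coeff 0 * (Ψ i).const).natAbs ∣ Δ)
    {m : ℕ} (hm : 2 ≤ m) (x : ℕ) :
    ∏ p ∈ (Nat.primesLE x).filter (fun p => ¬ p < m),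
        (1 - sectionDensity Ψ i p) / (1 - (p : ℝ)⁻¹) ≤
      (1 - (m : ℝ)⁻¹)⁻¹ ^ Δ.primeFactors.card := by
  have hm1 : (1 : ℝ) < m := by exact_mod_cast hm
  have hm0 : (0 : ℝ) < m := by linarith
  have hr0 : 0 < 1 - (m : ℝ)⁻¹ := sub_pos.mpr (inv_lt_one_of_one_lt₀ hm1)
  have hr1 : 1 ≤ (1 - (m : ℝ)⁻¹)⁻¹ :=
    (one_le_inv₀ hr0).mpr (sub_le_self _ (inv_nonneg.mpr hm0.le))
  have hprime : ∀ p ∈ (Nat.primesLE x).filter (fun p => ¬ p < m), p.Prime := fun p hp =>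
    Nat.prime_of_mem_primesLE (Finset.mem_filter.mp hp).1
  have hstep : ∀ p ∈ (Nat.primesLE x).filter (fun p => ¬ p < m),
      (1 - sectionDensity Ψ i p) / (1 - (p : ℝ)⁻¹) ≤
        if p ∣ Δ then (1 - (m : ℝ)⁻¹)⁻¹ else 1 := by
    intro p hp
    have hp' := hprime p hp
    by_cases hpd : p ∣ Δ
    · rw [if_pos hpd]
      have hmp : (m : ℝ) ≤ p := by exact_mod_cast not_lt.mp (Finset.mem_filter.mp hp).2
      exact (eulerFactor_le_inv Ψ i hp').trans
        (inv_anti₀ hr0 (sub_le_sub_left (inv_anti₀ hm0 hmp) 1))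
    · rw [if_neg hpd]
      exact eulerFactor_le_one Ψ i hΔa hΔD hp' hpd
  calc ∏ p ∈ (Nat.primesLE x).filter (fun p => ¬ p < m),
        (1 - sectionDensity Ψ i p) / (1 - (p : ℝ)⁻¹)
      ≤ ∏ p ∈ (Nat.primesLE x).filter (fun p => ¬ p < m),
          (if p ∣ Δ then (1 - (m : ℝ)⁻¹)⁻¹ else 1) :=
        Finset.prod_le_prod (fun p hp => MertensAux.eulerFactor_nonneg Ψ i (hprime p hp)
          (hg1 p (hprime p hp))) hstep
    _ = (1 - (m : ℝ)⁻¹)⁻¹ ^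
          (((Nat.primesLE x).filter (fun p => ¬ p < m)).filter (fun p => p ∣ Δ)).card := by
        rw [← Finset.prod_filter, Finset.prod_const]
    _ ≤ (1 - (m : ℝ)⁻¹)⁻¹ ^ Δ.primeFactors.card :=
        pow_le_pow_right₀ hr1 (Finset.card_le_card fun p hp => by
          obtain ⟨hp1, hpd⟩ := Finset.mem_filter.mp hp
          exact Nat.mem_primeFactors.mpr ⟨hprime p hp1, hpd, hΔ0⟩)

/-! ## The number of prime factors of the cross-discriminant -/

/-- `ω(n) ≤ 2k log N` when `0 ≠ n ≤ N^k`: `ω(n) log 2 ≤ log n` (the tree's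
`card_primeFactors_mul_log_le`, every prime factor being `≥ 2`), `log n ≤ k log N` and
`log 2 ≥ 1/2`. [folklore] -/
theorem card_primeFactors_le_log {n N k : ℕ} (hn : n ≠ 0) (hnN : n ≤ N ^ k) :
    (n.primeFactors.card : ℝ) ≤ 2 * k * Real.log N := by
  have h1 : (n.primeFactors.card : ℝ) * Real.log 2 ≤ Real.log n :=
    card_primeFactors_mul_log_le two_pos hn fun p hp => by
      exact_mod_cast (Nat.prime_of_mem_primeFactors hp).two_le
  have h2 : Real.log n ≤ k * Real.log N := by
    rw [← Real.log_pow]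
    exact Real.log_le_log (by exact_mod_cast Nat.pos_of_ne_zero hn) (by exact_mod_cast hnN)
  have hl2 : 1 - (2 : ℝ)⁻¹ ≤ Real.log 2 := Real.one_sub_inv_le_log_of_pos two_pos
  have hω0 : (0 : ℝ) ≤ n.primeFactors.card := Nat.cast_nonneg _
  nlinarith [mul_le_mul_of_nonneg_left hl2 hω0]

/-! ## The head from below -/

/-- **The head of Bombieri's constant from below**: for `N ≥ L(2L²)^t + 1` (so that
`Δ ≤ L(2L²N)^t ≤ N^{t+1}` and `ω(Δ) ≤ (2t+2) log N`) and `m ≥ 2`,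
`H_{Ψ,i} (1 - (2t+2) log N/m) ≤ H_{Ψ,i} (1 - ω(Δ)/m) ≤ H_{Ψ,i} (1 - 1/m)^{ω(Δ)} ≤ ∏_{p<m} E_p`,
the last step being the limit of `(∏_{p ≤ x} E_p)(1 - 1/m)^{ω(Δ)} ≤ ∏_{p<m} E_p` (`tail_le`). -/
theorem lowerHead (Ψ : Fin (t + 1) → AffLinForm 1) (hΨ : IsNondegenerateSystem Ψ) {L N : ℕ}
    (hN : L * (2 * L ^ 2) ^ t + 1 ≤ N) (hL : affLinSize Ψ N ≤ L) (i : Fin (t + 1))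
    (hg1 : ∀ p : ℕ, p.Prime → sectionDensity Ψ i p < 1)
    (hne : singularProduct (Fin.removeNth i Ψ) ≠ 0) {m : ℕ} (hm : 2 ≤ m) :
    sectionH Ψ i * (1 - (2 * (t : ℝ) + 2) * Real.log N / m) ≤
      ∏ p ∈ Nat.primesBelow m, (1 - sectionDensity Ψ i p) / (1 - (p : ℝ)⁻¹) := by
  have hNpos : 0 < N := by omega
  -- the cross-discriminant `Δ` and its number of prime factors `ω`
  have hΔ0 := SingularRatio.crossDisc_ne_zero Ψ hΨ i
  have hΔle := SingularRatio.crossDisc_le Ψ hNpos hL i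
  set Δ : ℕ := ((Ψ i).coeff 0).natAbs * ∏ k : Fin t, ((Ψ i).coeff 0 * (Ψ (i.succAbove k)).const -
      (Ψ (i.succAbove k)).coeff 0 * (Ψ i).const).natAbs with hΔdef
  have hΔa : ((Ψ i).coeff 0).natAbs ∣ Δ := Dvd.intro _ rfl
  have hΔD : ∀ k : Fin t, ((Ψ i).coeff 0 * (Ψ (i.succAbove k)).const -
      (Ψ (i.succAbove k)).coeff 0 * (Ψ i).const).natAbs ∣ Δ := fun k =>
    (Finset.dvd_prod_of_mem _ (Finset.mem_univ k)).mul_left _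
  have hΔN : Δ ≤ N ^ (t + 1) :=
    calc Δ ≤ L * (2 * L ^ 2 * N) ^ t := hΔle
      _ = L * (2 * L ^ 2) ^ t * N ^ t := by rw [mul_pow, mul_assoc]
      _ ≤ N * N ^ t := Nat.mul_le_mul_right _ (by omega)
      _ = N ^ (t + 1) := by rw [pow_succ, mul_comm]
  set ω : ℕ := Δ.primeFactors.card with hωdef
  have hω : (ω : ℝ) ≤ 2 * (t + 1 : ℕ) * Real.log N := card_primeFactors_le_log hΔ0 hΔN
  -- the head `P ≥ 0` and the ratio `r = 1 - 1/m ∈ (0, 1]`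
  set P : ℝ := ∏ p ∈ Nat.primesBelow m, (1 - sectionDensity Ψ i p) / (1 - (p : ℝ)⁻¹) with hP
  have hP0 : 0 ≤ P := Finset.prod_nonneg fun p hp =>
    MertensAux.eulerFactor_nonneg Ψ i (Nat.prime_of_mem_primesBelow hp)
      (hg1 p (Nat.prime_of_mem_primesBelow hp))
  have hm1 : (1 : ℝ) < m := by exact_mod_cast hm
  have hm0 : (0 : ℝ) < m := by linarith
  set r : ℝ := 1 - (m : ℝ)⁻¹ with hr
  have hr0 : 0 < r := sub_pos.mpr (inv_lt_one_of_one_lt₀ hm1)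
  -- `(∏_{p ≤ x} E_p) r^ω ≤ P` for `x + 1 ≥ m`, and its limit
  have hlow : ∀ x : ℕ, m ≤ x + 1 →
      (∏ p ∈ Nat.primesLE x, (1 - sectionDensity Ψ i p) / (1 - (p : ℝ)⁻¹)) * r ^ ω ≤ P := by
    intro x hx
    have htail := tail_le Ψ i hg1 hΔ0 hΔa hΔD hm x
    have hsplit : ∏ p ∈ Nat.primesLE x, (1 - sectionDensity Ψ i p) / (1 - (p : ℝ)⁻¹) =
        P * ∏ p ∈ (Nat.primesLE x).filter (fun p => ¬ p < m),
          (1 - sectionDensity Ψ i p) / (1 - (p : ℝ)⁻¹) := by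
      rw [hP, ← MertensAux.filter_primesLE_lt hx]
      exact (Finset.prod_filter_mul_prod_filter_not _ _ _).symm
    rw [hsplit, mul_assoc]
    refine mul_le_of_le_one_right hP0 ?_
    calc (∏ p ∈ (Nat.primesLE x).filter (fun p => ¬ p < m),
            (1 - sectionDensity Ψ i p) / (1 - (p : ℝ)⁻¹)) * r ^ ω
        ≤ r⁻¹ ^ ω * r ^ ω := mul_le_mul_of_nonneg_right htail (pow_nonneg hr0.le _)
      _ = 1 := by rw [← mul_pow, inv_mul_cancel₀ hr0.ne', one_pow]
  have hlim : sectionH Ψ i * r ^ ω ≤ P :=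
    le_of_tendsto ((MertensAux.tendsto_eulerPartial Ψ hΨ i hne).mul_const (r ^ ω))
      (eventually_atTop.2 ⟨m, fun x hx => hlow x (by omega)⟩)
  have hH0 : 0 ≤ sectionH Ψ i := MertensAux.sectionH_nonneg Ψ hΨ i hne
  -- Bernoulli: `1 - ω/m ≤ r^ω`
  have hB : 1 - (ω : ℝ) * (m : ℝ)⁻¹ ≤ r ^ ω := by
    have h := one_add_mul_le_pow (a := -(m : ℝ)⁻¹)
      (by linarith [(inv_lt_one_of_one_lt₀ hm1 : (m : ℝ)⁻¹ < 1)]) ω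
    calc 1 - (ω : ℝ) * (m : ℝ)⁻¹ = 1 + ω * (-(m : ℝ)⁻¹) := by ring
      _ ≤ (1 + -(m : ℝ)⁻¹) ^ ω := h
      _ = r ^ ω := by rw [hr, sub_eq_add_neg]
  have hC : 1 - (2 * (t : ℝ) + 2) * Real.log N / m ≤ 1 - (ω : ℝ) * (m : ℝ)⁻¹ := by
    rw [div_eq_mul_inv]
    refine sub_le_sub_left (mul_le_mul_of_nonneg_right ?_ (inv_nonneg.mpr hm0.le)) 1
    push_cast at hω
    linarith
  calc sectionH Ψ i * (1 - (2 * (t : ℝ) + 2) * Real.log N / m)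
      ≤ sectionH Ψ i * (1 - (ω : ℝ) * (m : ℝ)⁻¹) := mul_le_mul_of_nonneg_left hC hH0
    _ ≤ sectionH Ψ i * r ^ ω := mul_le_mul_of_nonneg_left hB hH0
    _ ≤ P := hlim

end SectionMertensLowerHeadAux

/-- **`stub_sectionMertensLowerHead`** (registered stub of the line `section-annihilator`, skeleton v13):
the head of Bombieri's constant from below, `SectionMertensLowerHead` with `C = 2t + 2` and
`N₀ = L(2L²)^t + 1` — for non-degenerate `(t+1)`-form systems of size `≤ L`, coordinates `i` with
`g(p) < 1` at every prime and `𝔖(Ψ₋ᵢ) ≠ 0`, and `m > L`, `m ≥ 2t + 2`: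
`H_{Ψ,i} (1 - C log N/m) ≤ ∏_{p<m} (1 - g(p))/(1 - 1/p)` (`SectionMertensLowerHeadAux.lowerHead`;
only `m ≥ 2` is used). -/
theorem stub_sectionMertensLowerHead : SectionMertensLowerHead := by
  intro t L
  refine ⟨2 * (t : ℝ) + 2, by positivity, L * (2 * L ^ 2) ^ t + 1,
    fun N hN Ψ hΨ hL i hg1 hne m _ htm => ?_⟩
  exact SectionMertensLowerHeadAux.lowerHead Ψ hΨ hN hL i hg1 hne (by omega)

end Summit.Parity.GeneralizedHardyLittlewood.Cruxes.CellParityLaw.SectionAnnihilator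

end
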